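import Summits.CriticalPhenomena.PercolationContinuityZ3.Theorems.SahiMasterFamilyUCBernsteinPartialUnions
import Summits.CriticalPhenomena.PercolationContinuityZ3.Theorems.SahiMasterFamilyUCBernstein
import Mathlib.Algebra.MvPolynomial.Funext

/-!
# `BPosS` ⇒ nonnegative layer sums: conjecture (B) (`UCBernstein.layerSum ≥ 0`, the typed `UCBernsteinNonneg` shape) for every finite collection of
# union-closed families with union-closed partial unions — chains of any length, collections of up-sets — every order

Unit `prim-masterthm-p4` (gen 22; crux anchor stmt-CriticalPhenomena-4575, helper work; memo
`run/shared/lean/prim/prim-masterthm/prim-masterthm-p4/P4-GEN22-REPORT.md` §2b).  Bridge between `…UCBernsteinPartialUnions` (the mixture functional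
`w ↦ Φ_{n+1}(Σ_x w_x 1_{𝒰_x})` is `BPosS (n+1)`: on the simplex a nonnegative combination of monomials of degree `≤ n+1`) and the typed conjecture (B) of `…UCBernstein`
(`layerSum 𝒰 j ≥ 0`: the patchwork layer sums, i.e. the degree-`(n+1)` Bernstein coefficients of the mixture polynomial on the simplex).

**THEOREM** `layerSum_nonneg_of_partialUnions`: if `𝒰 : α → Finset (Finset (Fin (n+1)))` (`α` finite) has `⋃_{x∈Y} 𝒰_x` union-closed for every `Y ⊆ α` (no top
condition), then `0 ≤ UCBernstein.layerSum 𝒰 j` for EVERY type `j` — conjecture (B) holds verbatim for the collection; corollaries `layerSum_nonneg_of_chain` (every finite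
chain of union-closed families) and `layerSum_nonneg_of_upper` (every finite collection of up-sets).
INGREDIENTS: (1) `simplex_coeff_nonneg` — UNIQUENESS OF THE BERNSTEIN REPRESENTATION ON THE SIMPLEX: if `f` is `BPosS d` and also `f(w) = Σ_{j∈J} L_j ∏_x w_x^{j_x}` on the
simplex with all `|j| = d`, then every `L_j ≥ 0`.  Proof: the homogeneous degree-`d` polynomials `P₁ = Σ_j L_j X^j` and `P₂ = Σ_i a_i X^{e_i} (Σ_x X_x)^{d−|e_i|}` agree at
every `w` with `Σ w ≠ 0` (scale to the simplex), so `(P₁ − P₂)·(Σ_x X_x)` vanishes identically, hence is `0` (`MvPolynomial.funext`), hence `P₁ = P₂` (integral domain),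
and the coefficients of `P₂` are nonnegative (products and sums of polynomials with nonnegative coefficients).  (2) `phiSet_mixS_eq_sum_layerSum` — the patchwork
decomposition of `…UCBernstein` grouped by type.  HONEST FRAMING: (B) for general collections (already two general families), `UCHullNonneg k` (k ≥ 8), Sahi's `C_k`
and the master theorem remain OPEN.  Axioms standard. [this work]
-/

noncomputable section

open scoped Classical

namespace Summit.CriticalPhenomena.PercolationContinuityZ3.Theorems

namespace UCBernsteinSimplexLayers

open Finset Function
open Literature.Combinatorics.Sahi2008
open PrincipalCapBeta (phiSet)
open BernsteinPos BernsteinSimplex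

variable {α : Type} [Fintype α]

/-! ### Polynomials with nonnegative coefficients -/

omit [Fintype α] in
/-- Monomials with a nonnegative coefficient have nonnegative coefficients. [this work] -/
theorem nncoeff_monomial (m : α →₀ ℕ) {c : ℝ} (hc : 0 ≤ c) : ∀ m', 0 ≤ MvPolynomial.coeff m' (MvPolynomial.monomial m c) := by
  intro m'
  rw [MvPolynomial.coeff_monomial]
  split_ifs
  · exact hc
  · exact le_rfl

omit [Fintype α] in
/-- Nonnegative constants have nonnegative coefficients. [this work] -/
theorem nncoeff_C {c : ℝ} (hc : 0 ≤ c) : ∀ m, 0 ≤ MvPolynomial.coeff m (MvPolynomial.C c : MvPolynomial α ℝ) := by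
  intro m
  rw [MvPolynomial.coeff_C]
  split_ifs
  · exact hc
  · exact le_rfl

omit [Fintype α] in
/-- Variables have nonnegative coefficients. [this work] -/
theorem nncoeff_X (x : α) : ∀ m, 0 ≤ MvPolynomial.coeff m (MvPolynomial.X x : MvPolynomial α ℝ) := by
  intro m
  rw [MvPolynomial.coeff_X]
  split_ifs
  · exact zero_le_one
  · exact le_rfl

omit [Fintype α] in
/-- Products of polynomials with nonnegative coefficients. [this work] -/
theorem nncoeff_mul {P Q : MvPolynomial α ℝ} (hP : ∀ m, 0 ≤ MvPolynomial.coeff m P) (hQ : ∀ m, 0 ≤ MvPolynomial.coeff m Q) :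
    ∀ m, 0 ≤ MvPolynomial.coeff m (P * Q) := fun m => by
  rw [MvPolynomial.coeff_mul]
  exact sum_nonneg fun x _ => mul_nonneg (hP _) (hQ _)

omit [Fintype α] in
/-- Finite sums of polynomials with nonnegative coefficients. [this work] -/
theorem nncoeff_sum {κ : Type*} (s : Finset κ) (P : κ → MvPolynomial α ℝ) (h : ∀ i ∈ s, ∀ m, 0 ≤ MvPolynomial.coeff m (P i)) :
    ∀ m, 0 ≤ MvPolynomial.coeff m (∑ i ∈ s, P i) := fun m => by
  rw [MvPolynomial.coeff_sum]
  exact sum_nonneg fun i hi => h i hi m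

omit [Fintype α] in
/-- Powers of a polynomial with nonnegative coefficients. [this work] -/
theorem nncoeff_pow {P : MvPolynomial α ℝ} (hP : ∀ m, 0 ≤ MvPolynomial.coeff m P) : ∀ k : ℕ, ∀ m, 0 ≤ MvPolynomial.coeff m (P ^ k)
  | 0 => by rw [pow_zero, ← MvPolynomial.C_1]; exact nncoeff_C zero_le_one
  | k + 1 => by rw [pow_succ]; exact nncoeff_mul (nncoeff_pow hP k) hP

/-! ### Uniqueness of the Bernstein representation on the simplex -/

/-- Evaluation of a monomial with exponent vector given as a function. [folklore] -/
theorem eval_monomial_fun (j : α → ℕ) (c : ℝ) (w : α → ℝ) :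
    MvPolynomial.eval w (MvPolynomial.monomial (Finsupp.equivFunOnFinite.symm j) c) = c * ∏ x, w x ^ j x := by
  rw [MvPolynomial.eval_monomial, Finsupp.prod_fintype]
  · simp
  · intro i; exact pow_zero _

/-- The sum of the variables does not vanish. [folklore] -/
theorem sum_X_ne_zero [Nonempty α] : (∑ x : α, (MvPolynomial.X x : MvPolynomial α ℝ)) ≠ 0 := by
  obtain ⟨x0⟩ := ‹Nonempty α›
  intro h
  have := congrArg (MvPolynomial.coeff (Finsupp.single x0 1)) h
  rw [MvPolynomial.coeff_sum, MvPolynomial.coeff_zero] at this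
  simp only [MvPolynomial.coeff_X, Finsupp.single_eq_single_iff] at this
  simp at this

/-- Scaling a monomial to the simplex: `∏_x (w_x/s)^{j_x} = (∏_x w_x^{j_x}) / s^{Σ j}`. [folklore] -/
theorem prod_div_pow (w : α → ℝ) (s : ℝ) (j : α → ℕ) : ∏ x, (w x / s) ^ j x = (∏ x, w x ^ j x) / s ^ (∑ x, j x) := by
  simp_rw [div_pow]
  rw [prod_div_distrib, prod_pow_eq_pow_sum]

/-- **Uniqueness of the Bernstein representation on the simplex.**  If `f` is `BPosS d` and, on the simplex, also `f(w) = Σ_{j∈J} L_j ∏_x w_x^{j_x}` with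
`Σ_x j_x = d` for all `j ∈ J`, then `L_j ≥ 0` for every `j ∈ J`. [this work] -/
theorem simplex_coeff_nonneg [Nonempty α] {d : ℕ} {f : (α → ℝ) → ℝ} (hf : BPosS d f) (L : (α → ℕ) → ℝ) (J : Finset (α → ℕ))
    (hJ : ∀ j ∈ J, ∑ x, j x = d) (hL : ∀ w : α → ℝ, ∑ x, w x = 1 → f w = ∑ j ∈ J, L j * ∏ x, w x ^ j x) :
    ∀ j ∈ J, 0 ≤ L j := by
  obtain ⟨ι, hι, a, e, ha, he, hf'⟩ := hf
  let F : (α → ℕ) → (α →₀ ℕ) := fun j => Finsupp.equivFunOnFinite.symm j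
  let S : MvPolynomial α ℝ := ∑ x, MvPolynomial.X x
  let P₁ : MvPolynomial α ℝ := ∑ j ∈ J, MvPolynomial.monomial (F j) (L j)
  let P₂ : MvPolynomial α ℝ := ∑ i, MvPolynomial.C (a i) * (MvPolynomial.monomial (F (e i)) 1 * S ^ (d - ∑ x, e i x))
  have evS : ∀ w : α → ℝ, MvPolynomial.eval w S = ∑ x, w x := fun w => by
    simp only [S, map_sum, MvPolynomial.eval_X]
  have ev1 : ∀ w : α → ℝ, MvPolynomial.eval w P₁ = ∑ j ∈ J, L j * ∏ x, w x ^ j x := fun w => by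
    simp only [P₁, map_sum, F, eval_monomial_fun]
  have ev2 : ∀ w : α → ℝ, MvPolynomial.eval w P₂ = ∑ i, a i * ((∏ x, w x ^ e i x) * (∑ x, w x) ^ (d - ∑ x, e i x)) := fun w => by
    simp only [P₂, map_sum, map_mul, MvPolynomial.eval_C, F, eval_monomial_fun, one_mul, map_pow, evS]
  -- the two homogeneous polynomials agree off the hyperplane `Σ w = 0`
  have key : ∀ w : α → ℝ, (∑ x, w x) ≠ 0 → MvPolynomial.eval w P₁ = MvPolynomial.eval w P₂ := by
    intro w hs
    set s := ∑ x, w x with hsdef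
    have hw' : ∑ x, w x / s = 1 := by rw [← sum_div, ← hsdef, div_self hs]
    have H := (hL (fun x => w x / s) hw').symm.trans (hf' (fun x => w x / s) hw')
    rw [ev1, ev2]
    have hA : ∀ j ∈ J, L j * ∏ x, w x ^ j x = s ^ d * (L j * ∏ x, (w x / s) ^ j x) := by
      intro j hj
      rw [prod_div_pow, hJ j hj]
      field_simp
    have hB : ∀ i, a i * ((∏ x, w x ^ e i x) * s ^ (d - ∑ x, e i x)) = s ^ d * (a i * ∏ x, (w x / s) ^ e i x) := by
      intro i
      rw [prod_div_pow]
      have hsd : s ^ d = s ^ (∑ x, e i x) * s ^ (d - ∑ x, e i x) := by rw [← pow_add, Nat.add_sub_cancel' (he i)]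
      have hne : s ^ (∑ x, e i x) ≠ 0 := pow_ne_zero _ hs
      rw [hsd]
      field_simp
    rw [sum_congr rfl hA, sum_congr rfl (fun i _ => hB i), ← mul_sum, ← mul_sum, H]
  -- hence they are equal
  have hPQ : P₁ = P₂ := by
    have h0 : (P₁ - P₂) * S = 0 := by
      refine MvPolynomial.funext fun w => ?_
      rw [map_mul, map_sub, map_zero, evS]
      by_cases hs : (∑ x, w x) = 0
      · rw [hs, mul_zero]
      · rw [key w hs, sub_self, zero_mul]
    exact sub_eq_zero.1 ((mul_eq_zero.1 h0).resolve_right sum_X_ne_zero)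
  -- compare coefficients
  have hNN : ∀ m, 0 ≤ MvPolynomial.coeff m P₂ :=
    nncoeff_sum _ _ fun i _ => nncoeff_mul (nncoeff_C (ha i))
      (nncoeff_mul (nncoeff_monomial _ zero_le_one) (nncoeff_pow (nncoeff_sum _ _ fun x _ => nncoeff_X x) _))
  intro j hj
  have c1 : MvPolynomial.coeff (F j) P₁ = L j := by
    rw [MvPolynomial.coeff_sum]
    have e1 : ∀ j' ∈ J, MvPolynomial.coeff (F j) (MvPolynomial.monomial (F j') (L j')) = if j = j' then L j' else 0 := by
      intro j' _
      rw [MvPolynomial.coeff_monomial]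
      by_cases h : j = j'
      · rw [if_pos (by rw [h]), if_pos h]
      · rw [if_neg (fun h' => h (Finsupp.equivFunOnFinite.symm.injective h').symm), if_neg h]
    rw [sum_congr rfl e1, sum_ite_eq, if_pos hj]
  rw [← c1, hPQ]
  exact hNN _

/-! ### The patchwork decomposition grouped by type -/

variable {n : ℕ}

/-- The label counts of a labelling add up to the number of elements. [this work] -/
theorem sum_ltype (ℓ : Fin n → α) : ∑ x, UCBernstein.ltype ℓ x = n := by
  unfold UCBernstein.ltype
  have h := (Finset.card_eq_sum_card_fiberwise (s := (univ : Finset (Fin n))) (t := (univ : Finset α)) (f := ℓ)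
    (fun i _ => mem_univ _)).symm
  rw [card_univ, Fintype.card_fin] at h
  convert h using 2

/-- **`Φ_{n+1}(Σ_x w_x 1_{𝒰_x}) = Σ_j N_j ∏_x w_x^{j_x}`** on the simplex, `N_j = layerSum 𝒰 j`, the sum over the types of labellings (the patchwork decomposition of
`…UCBernstein` grouped by type). [this work] -/
theorem phiSet_mixS_eq_sum_layerSum (𝒰 : α → Finset (Finset (Fin (n + 1)))) (w : α → ℝ) (hw : ∑ x, w x = 1) :
    phiSet (n + 1) (mixS 𝒰 w) =
      ∑ j ∈ (univ : Finset (Fin (n + 1) → α)).image UCBernstein.ltype, UCBernstein.layerSum 𝒰 j * ∏ x, w x ^ j x := by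
  have h := UCBernstein.phiSet_mixture_eq_sum_patchwork w hw 𝒰
  have hmix : (fun S : Finset (Fin (n + 1)) => ∑ x, w x * (if S ∈ 𝒰 x then (1 : ℝ) else 0)) = mixS 𝒰 w := rfl
  rw [hmix] at h
  rw [h, ← Finset.sum_fiberwise_of_maps_to (s := (univ : Finset (Fin (n + 1) → α)))
    (t := (univ : Finset (Fin (n + 1) → α)).image UCBernstein.ltype) (g := UCBernstein.ltype)
    (fun ℓ _ => mem_image_of_mem _ (mem_univ ℓ))]
  refine sum_congr rfl fun j _ => ?_
  unfold UCBernstein.layerSum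
  rw [mul_comm, mul_sum]
  refine sum_congr rfl fun ℓ hℓ => ?_
  rw [UCBernstein.prod_label_eq_prod_pow, (mem_filter.1 hℓ).2]

/-! ### (B) for collections with union-closed partial unions, in the language of `…UCBernstein` -/

/-- **Layer sums are nonnegative** for every finite collection of families of subsets of `Fin (n+1)` all of whose partial unions are union-closed, every type,
every order. [this work] -/
theorem layerSum_nonneg_of_partialUnions (𝒰 : α → Finset (Finset (Fin (n + 1))))
    (hPU : ∀ Y : Finset α, ∀ A ∈ Y.biUnion 𝒰, ∀ B ∈ Y.biUnion 𝒰, A ∪ B ∈ Y.biUnion 𝒰) (j : α → ℕ) :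
    0 ≤ UCBernstein.layerSum 𝒰 j := by
  by_cases hj : j ∈ (univ : Finset (Fin (n + 1) → α)).image UCBernstein.ltype
  · haveI : Nonempty α := by
      obtain ⟨ℓ, _, _⟩ := mem_image.1 hj
      exact ⟨ℓ 0⟩
    exact simplex_coeff_nonneg (UCBernsteinPartialUnions.bposS_phiSet_mixS_of_partialUnions n 𝒰 hPU) (UCBernstein.layerSum 𝒰)
      ((univ : Finset (Fin (n + 1) → α)).image UCBernstein.ltype)
      (fun j' hj' => by
        obtain ⟨ℓ, _, rfl⟩ := mem_image.1 hj'
        exact sum_ltype ℓ)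
      (fun w hw => phiSet_mixS_eq_sum_layerSum 𝒰 w hw) j hj
  · unfold UCBernstein.layerSum
    refine le_of_eq (sum_eq_zero fun ℓ hℓ => ?_).symm
    exact absurd (mem_image.2 ⟨ℓ, mem_univ _, (mem_filter.1 hℓ).2⟩) hj

/-- **(B) for every finite chain of union-closed families** (layer sums). [this work] -/
theorem layerSum_nonneg_of_chain (𝒰 : α → Finset (Finset (Fin (n + 1)))) (hUC : ∀ x, ∀ A ∈ 𝒰 x, ∀ B ∈ 𝒰 x, A ∪ B ∈ 𝒰 x)
    (hchain : ∀ x y, 𝒰 x ⊆ 𝒰 y ∨ 𝒰 y ⊆ 𝒰 x) (j : α → ℕ) : 0 ≤ UCBernstein.layerSum 𝒰 j := by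
  refine layerSum_nonneg_of_partialUnions 𝒰 (fun Y A hA B hB => ?_) j
  obtain ⟨x, hx, hAx⟩ := mem_biUnion.1 hA
  obtain ⟨y, hy, hBy⟩ := mem_biUnion.1 hB
  rcases hchain x y with h | h
  · exact mem_biUnion.2 ⟨y, hy, hUC y _ (h hAx) _ hBy⟩
  · exact mem_biUnion.2 ⟨x, hx, hUC x _ hAx _ (h hBy)⟩

/-- **(B) for every finite collection of up-sets** (layer sums). [this work] -/
theorem layerSum_nonneg_of_upper (𝒰 : α → Finset (Finset (Fin (n + 1))))
    (hup : ∀ x, ∀ A ∈ 𝒰 x, ∀ B : Finset (Fin (n + 1)), A ⊆ B → B ∈ 𝒰 x) (j : α → ℕ) : 0 ≤ UCBernstein.layerSum 𝒰 j := by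
  refine layerSum_nonneg_of_partialUnions 𝒰 (fun Y A hA B _ => ?_) j
  obtain ⟨x, hx, hAx⟩ := mem_biUnion.1 hA
  exact mem_biUnion.2 ⟨x, hx, hup x A hAx _ subset_union_left⟩

end UCBernsteinSimplexLayers

end Summit.CriticalPhenomena.PercolationContinuityZ3.Theorems
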